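import Summits.Ventures.PercRepro.Night2Coloop
import Summits.Ventures.PercRepro.MatroidColoopStepA

/-!
# PercRepro — night-2: the FIRST-LAYER reduction for C-025 (blind cell pub-perc-repro)

Theorem 3 of `proofs/NIGHT-2-injection.md`. For a finite matroid `M` (ground `Finset` `E`) and integers `p, q`:
`U = {B ⊆ E : r(B) = q, r(E ∖ B) = p}` (the complements of the row's first family), `𝒮 = {S ⊆ E : r(S) = q+1}`,
`𝒯 = {T ⊆ E : r(T) = q, T ⊇ some B ∈ U}`, `K(T)` = coloops of the set `T` (`setColoops`), and for a flat `F`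
`U_F = {B ∈ U : cl B = F}`, `𝒯_F = {T ∈ 𝒯 : cl T = F}`.

* `pairWeight_le_card_level` — Σ_{T ∈ 𝒯} |E ∖ cl T| / (|K(T)| + 1) ≤ |𝒮|: every rank-(q+1) set `S` above a `U`-set is
  `T ∪ {e}` for its coloops `e` only (Lemma 1 / Cor. 2 of `Night2Coloop`), and the pairs `(T, e)` are counted with weight
  `1/|K(S)|` each, at most once per coloop.
* `firstLayer_of_perFlat` — THEOREM 3: if every flat `F` carrying a `U`-set satisfies (L1-F)
  `p · |U_F| ≤ (q+1) · Σ_{T ∈ 𝒯_F} |E ∖ F| / (|K(T)|+1)` (`PerFlat`), then `p · |U| ≤ (q+1) · |𝒮|`.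
* `levelOne_of_perFlat` — the same in typer-2's vocabulary: `LevelOne M p q` (= level `u = q+1` of `Levelwise M p q`,
  `C(p+q,q+1)·topCount ≤ C(p+q,p)·levelCount (q+1)`; at `p = q+2` it is the row C-025 itself).
* `perFlat_term_of_cospanning`, `levelOne_of_cospanning` — Proposition 4 / Corollary 5: a flat whose complement spans
  (`t₀ = 0`) satisfies (L1-F) automatically, so `LevelOne` holds whenever every `U`-carrying flat is co-spanning.
-/

namespace PercRepro
namespace Matroid

open Set Finset
open scoped Classical

variable {α : Type*} (M : _root_.Matroid α) (E : Finset α) (p q : ℕ)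

/-- `U`: the subsets `B ⊆ E` with `r(B) = q` and `r(E ∖ B) = p`. -/
noncomputable def topFam : Finset (Finset α) :=
  E.powerset.filter (fun B => M.eRk (↑B : Set α) = (q : ℕ∞) ∧ M.eRk ((↑E : Set α) \ ↑B) = (p : ℕ∞))

/-- `𝒮`: the subsets of `E` of rank `u`. -/
noncomputable def levelFam (u : ℕ) : Finset (Finset α) :=
  E.powerset.filter (fun S => M.eRk (↑S : Set α) = (u : ℕ∞))

/-- `𝒯`: the rank-`q` subsets of `E` containing a member of `U`. -/
noncomputable def upFam : Finset (Finset α) :=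
  E.powerset.filter (fun T => M.eRk (↑T : Set α) = (q : ℕ∞) ∧ ∃ B ∈ topFam M E p q, B ⊆ T)

/-- The coloops of the finite set `T`, as a `Finset`. -/
noncomputable def coloopsF (T : Finset α) : Finset α :=
  T.filter (fun x => M.eRk ((↑T : Set α) \ {x}) < M.eRk (↑T : Set α))

/-- `coloopsF` is `setColoops`. -/
theorem coe_coloopsF (T : Finset α) : (↑(coloopsF M T) : Set α) = setColoops M ↑T := by
  ext x; simp [coloopsF, mem_setColoops_iff]

/-- The elements of `E` outside the closure of `T`. -/
noncomputable def outside (T : Finset α) : Finset α :=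
  E.filter (fun e => e ∉ M.closure (↑T : Set α))

/-- The weighted pair count `Ξ = Σ_{T ∈ 𝒯} |E ∖ cl T| / (|K(T)| + 1)`. -/
noncomputable def pairWeight : ℚ :=
  ∑ T ∈ upFam M E p q, ((outside M E T).card : ℚ) / ((coloopsF M T).card + 1)

/-- The pairs `(T, e)` with `T ∈ 𝒯`, `e ∈ E ∖ cl T`. -/
noncomputable def pairsT : Finset (Σ _ : Finset α, α) :=
  (upFam M E p q).sigma (fun T => outside M E T)

/-- The pairs `(S, e)` with `S ∈ 𝒮`, `e` a coloop of `S` and `S ∖ e ∈ 𝒯`. -/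
noncomputable def pairsS : Finset (Σ _ : Finset α, α) :=
  (levelFam M E (q + 1)).sigma (fun S => (coloopsF M S).filter (fun e => S.erase e ∈ upFam M E p q))



/-- `U_F`: the `U`-sets with closure `F`. -/
noncomputable def topFamF (F : Set α) : Finset (Finset α) :=
  (topFam M E p q).filter (fun B => M.closure (↑B : Set α) = F)

/-- `𝒯_F`: the members of `𝒯` with closure `F`. -/
noncomputable def upFamF (F : Set α) : Finset (Finset α) :=
  (upFam M E p q).filter (fun T => M.closure (↑T : Set α) = F)

/-- The flats carrying a `U`-set (as closures of members of `𝒯`; every such closure is the closure of a `U`-set). -/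
noncomputable def flatsU : Finset (Set α) :=
  (upFam M E p q).image (fun T : Finset α => M.closure (↑T : Set α))

/-- The closure of a member of `𝒯` is in `flatsU`. -/
theorem closure_mem_flatsU {T : Finset α} (hT : T ∈ upFam M E p q) :
    M.closure (↑T : Set α) ∈ flatsU M E p q :=
  Finset.mem_image_of_mem (fun T : Finset α => M.closure (↑T : Set α)) hT

/-- The per-flat hypothesis (L1-F) of Theorem 3. -/
def PerFlat : Prop :=
  ∀ F ∈ flatsU M E p q, (p : ℚ) * (topFamF M E p q F).card ≤
    (q + 1) * ∑ T ∈ upFamF M E p q F, ((outside M E T).card : ℚ) / ((coloopsF M T).card + 1)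


section Reduction

variable {M E p q}

/-- Membership in `topFam`. -/
theorem mem_topFam_iff {B : Finset α} :
    B ∈ topFam M E p q ↔ B ⊆ E ∧ M.eRk (↑B : Set α) = (q : ℕ∞) ∧ M.eRk ((↑E : Set α) \ ↑B) = (p : ℕ∞) := by
  simp [topFam]

/-- Membership in `levelFam`. -/
theorem mem_levelFam_iff {u : ℕ} {S : Finset α} :
    S ∈ levelFam M E u ↔ S ⊆ E ∧ M.eRk (↑S : Set α) = (u : ℕ∞) := by
  simp [levelFam]

/-- Membership in `upFam`. -/
theorem mem_upFam_iff {T : Finset α} :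
    T ∈ upFam M E p q ↔ T ⊆ E ∧ M.eRk (↑T : Set α) = (q : ℕ∞) ∧ ∃ B ∈ topFam M E p q, B ⊆ T := by
  simp [upFam]

/-- Membership in `coloopsF`. -/
theorem mem_coloopsF_iff {T : Finset α} {x : α} :
    x ∈ coloopsF M T ↔ x ∈ T ∧ M.eRk ((↑T : Set α) \ {x}) < M.eRk (↑T : Set α) := by
  simp [coloopsF]

/-- Membership in `outside`. -/
theorem mem_outside_iff {T : Finset α} {e : α} :
    e ∈ outside M E T ↔ e ∈ E ∧ e ∉ M.closure (↑T : Set α) := by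
  simp [outside]

/-- Every `U`-set is in `𝒯`. -/
theorem topFam_subset_upFam : topFam M E p q ⊆ upFam M E p q := by
  intro B hB
  rw [mem_topFam_iff] at hB
  exact mem_upFam_iff.2 ⟨hB.1, hB.2.1, B, mem_topFam_iff.2 hB, subset_rfl⟩

variable (hE : (↑E : Set α) ⊆ M.E)
include hE

/-- Lemma 1 in `Finset` form: for `T ⊆ E` and `e ∈ E ∖ cl T`, `K(T ∪ e) = K(T) ∪ {e}`. -/
theorem coloopsF_insert {T : Finset α} {e : α} (he : e ∈ outside M E T) :
    coloopsF M (insert e T) = insert e (coloopsF M T) := by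
  rw [mem_outside_iff] at he
  have h := setColoops_insert (M := M) (M.isRkFinite_of_finite (Finset.finite_toSet T))
    (e := e) ⟨hE he.1, he.2⟩
  apply Finset.coe_injective
  rw [coe_coloopsF, Finset.coe_insert, Finset.coe_insert, coe_coloopsF, h]

/-- `e ∉ cl T` with `T ⊆ E` forces `e ∉ T`. -/
theorem notMem_of_mem_outside {T : Finset α} {e : α} (he : e ∈ outside M E T) : e ∉ T := by
  rw [mem_outside_iff] at he
  intro heT
  exact he.2 (M.mem_closure_of_mem' (Finset.mem_coe.2 heT) (hE he.1))

omit hE in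
/-- `Ξ` as a sum over the pairs `(T, e)`. -/
theorem pairWeight_eq_sum_pairsT :
    pairWeight M E p q = ∑ x ∈ pairsT M E p q, (1 : ℚ) / ((coloopsF M x.1).card + 1) := by
  unfold pairWeight pairsT
  rw [Finset.sum_sigma]
  refine Finset.sum_congr rfl (fun T _ => ?_)
  dsimp only
  rw [Finset.sum_const, nsmul_eq_mul]
  field_simp

/-- The forward map `(T, e) ↦ (T ∪ e, e)` lands in `pairsS`. -/
theorem insert_mem_pairsS {x : Σ _ : Finset α, α} (hx : x ∈ pairsT M E p q) :
    (⟨insert x.2 x.1, x.2⟩ : Σ _ : Finset α, α) ∈ pairsS M E p q := by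
  obtain ⟨T, e⟩ := x
  simp only [pairsT, Finset.mem_sigma] at hx
  obtain ⟨hT, he⟩ := hx
  have hTE := (mem_upFam_iff.1 hT).1
  have hrk := (mem_upFam_iff.1 hT).2.1
  have heT : e ∉ T := notMem_of_mem_outside hE he
  have he' := mem_outside_iff.1 he
  simp only [pairsS, Finset.mem_sigma, Finset.mem_filter]
  refine ⟨?_, ?_, ?_⟩
  · rw [mem_levelFam_iff]
    refine ⟨Finset.insert_subset he'.1 hTE, ?_⟩
    rw [Finset.coe_insert, M.eRk_insert_eq_add_one ⟨hE he'.1, he'.2⟩, hrk]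
    push_cast; rfl
  · rw [coloopsF_insert hE he]
    exact Finset.mem_insert_self _ _
  · rw [Finset.erase_insert heT]
    exact hT

/-- The backward map `(S, e) ↦ (S ∖ e, e)` lands in `pairsT`. -/
theorem erase_mem_pairsT {x : Σ _ : Finset α, α} (hx : x ∈ pairsS M E p q) :
    (⟨x.1.erase x.2, x.2⟩ : Σ _ : Finset α, α) ∈ pairsT M E p q := by
  obtain ⟨S, e⟩ := x
  simp only [pairsS, Finset.mem_sigma, Finset.mem_filter] at hx
  obtain ⟨hS, he, hSe⟩ := hx
  have hSE := (mem_levelFam_iff.1 hS).1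
  simp only [pairsT, Finset.mem_sigma]
  refine ⟨hSe, ?_⟩
  rw [mem_outside_iff]
  refine ⟨hSE (mem_coloopsF_iff.1 he).1, ?_⟩
  have h2 := (eRk_diff_singleton_add_one_of_mem_setColoops (M := M) (S := (↑S : Set α))
    (Finset.coe_subset.2 hSE |>.trans hE) (by rw [← coe_coloopsF]; exact Finset.mem_coe.2 he)).2
  rwa [Finset.coe_erase]

/-- The two pair families correspond, and the weights match: `Ξ = Σ_{(S,e) ∈ pairsS} 1/|K(S)|`. -/
theorem pairWeight_eq_sum_pairsS :
    pairWeight M E p q = ∑ x ∈ pairsS M E p q, (1 : ℚ) / (coloopsF M x.1).card := by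
  rw [pairWeight_eq_sum_pairsT]
  refine Finset.sum_nbij' (fun x => ⟨insert x.2 x.1, x.2⟩) (fun x => ⟨x.1.erase x.2, x.2⟩)
    (fun x hx => insert_mem_pairsS hE hx) (fun x hx => erase_mem_pairsT hE hx) ?_ ?_ ?_
  · rintro ⟨T, e⟩ hx
    simp only [pairsT, Finset.mem_sigma] at hx
    have heT : e ∉ T := notMem_of_mem_outside hE hx.2
    simp only [Finset.erase_insert heT]
  · rintro ⟨S, e⟩ hx
    simp only [pairsS, Finset.mem_sigma, Finset.mem_filter] at hx
    simp only [Finset.insert_erase (mem_coloopsF_iff.1 hx.2.1).1]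
  · rintro ⟨T, e⟩ hx
    simp only [pairsT, Finset.mem_sigma] at hx
    have hTE := (mem_upFam_iff.1 hx.1).1
    have heT : e ∉ T := notMem_of_mem_outside hE hx.2
    simp only [coloopsF_insert hE hx.2]
    rw [Finset.card_insert_of_notMem (fun h => heT (mem_coloopsF_iff.1 h).1)]
    push_cast; rfl

/-- Each `S ∈ 𝒮` receives total weight at most `1`: `Ξ ≤ |𝒮|`. -/
theorem pairWeight_le_card_level :
    pairWeight M E p q ≤ ((levelFam M E (q + 1)).card : ℚ) := by
  rw [pairWeight_eq_sum_pairsS hE]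
  unfold pairsS
  rw [Finset.sum_sigma, Finset.card_eq_sum_ones, Nat.cast_sum]
  refine Finset.sum_le_sum (fun S _ => ?_)
  dsimp only
  rw [Finset.sum_const, nsmul_eq_mul]
  push_cast
  by_cases h0 : (coloopsF M S).card = 0
  · rw [h0]; simp
  · have hpos : (0 : ℚ) < (coloopsF M S).card := by exact_mod_cast Nat.pos_of_ne_zero h0
    calc (((coloopsF M S).filter (fun e => S.erase e ∈ upFam M E p q)).card : ℚ) * (1 / (coloopsF M S).card)
        ≤ ((coloopsF M S).card : ℚ) * (1 / (coloopsF M S).card) := by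
          gcongr
          exact Finset.filter_subset _ _
      _ = 1 := by field_simp

end Reduction

section Flats

variable {M E p q}

/-- `|U| = Σ_F |U_F|` over the flats carrying a `U`-set. -/
theorem card_topFam_eq_sum_fibres :
    (topFam M E p q).card = ∑ F ∈ flatsU M E p q, (topFamF M E p q F).card := by
  exact Finset.card_eq_sum_card_fiberwise (fun B hB => closure_mem_flatsU M E p q (topFam_subset_upFam hB))

/-- `Ξ = Σ_F Σ_{T ∈ 𝒯_F} |E ∖ cl T| / (|K(T)| + 1)`. -/
theorem pairWeight_eq_sum_fibres :
    pairWeight M E p q = ∑ F ∈ flatsU M E p q, ∑ T ∈ upFamF M E p q F,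
      ((outside M E T).card : ℚ) / ((coloopsF M T).card + 1) := by
  exact (Finset.sum_fiberwise_of_maps_to (s := upFam M E p q) (t := flatsU M E p q)
    (g := fun T : Finset α => M.closure (↑T : Set α)) (fun T hT => closure_mem_flatsU M E p q hT)
    (fun T => ((outside M E T).card : ℚ) / ((coloopsF M T).card + 1))).symm

/-- **THEOREM 3 (the first-layer reduction).** If every flat carrying a `U`-set satisfies (L1-F), then
`p · |U(p,q)| ≤ (q + 1) · |{S ⊆ E : r(S) = q + 1}|`. -/
theorem firstLayer_of_perFlat (hE : (↑E : Set α) ⊆ M.E) (h : PerFlat M E p q) :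
    (p : ℚ) * (topFam M E p q).card ≤ (q + 1) * (levelFam M E (q + 1)).card := by
  calc (p : ℚ) * (topFam M E p q).card
      = ∑ F ∈ flatsU M E p q, (p : ℚ) * (topFamF M E p q F).card := by
        rw [card_topFam_eq_sum_fibres, Nat.cast_sum, Finset.mul_sum]
    _ ≤ ∑ F ∈ flatsU M E p q, (q + 1) * ∑ T ∈ upFamF M E p q F,
          ((outside M E T).card : ℚ) / ((coloopsF M T).card + 1) :=
        Finset.sum_le_sum (fun F hF => h F hF)
    _ = (q + 1) * pairWeight M E p q := by
        rw [pairWeight_eq_sum_fibres, Finset.mul_sum]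
    _ ≤ (q + 1) * (levelFam M E (q + 1)).card := by
        gcongr
        exact pairWeight_le_card_level hE

end Flats

end Matroid
end PercRepro
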